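import Summits.HubbardSuperconductivity.HubbardSuperconductivity.Theorems.SsbToEvenTorusLro.Negative.SzLabelAndOddSector
import Summits.HubbardSuperconductivity.HubbardSuperconductivity.Theorems.NoGoNogoSingletPairKillsSaturatedFM
import Summits.HubbardSuperconductivity.HubbardSuperconductivity.Theorems.WcbcsSsbToTorusLRO.Negative.SummitMatrixUniformFloor

/-!
# Crux `SsbToEvenTorusLro` (item `stmt-HubbardSuperconductivity-1315`): saturated ferromagnetism kills the summit
matrix, and its energy form

Support file of the standing disprover (generation 2; workfile `Cruxes/SsbToEvenTorusLro/Disproof.lean`, §8(v),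
§8e–§8f), third file after `MatrixClausesAndBox.lean` and `SzLabelAndOddSector.lean`. No definition is introduced.
Proved:

* `not_hasDWavePairFieldLROAt_of_eventually_saturated` / `…_of_frequently_saturated` — if on all large tori
  (resp. on infinitely many even tori, `δ ≥ 0`) the sector `(N_L, S^z = 0)` of `hubbardTorus 2 L 1 U` contains a
  SATURATED ferromagnetic ground state (`S² = n(n+1)`, `n = N_L/2`), the summit matrix `HasDWavePairFieldLROAt U δ`
  fails: route NoGo's crux 5 (`Summit.HubbardSuperconductivity.NoGo.localPair_mulVec_eq_zero_of_saturated`, Tasaki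
  1998 p. 20) makes the `d`-wave pair correlations of that member vanish identically; the frequently-form goes through
  the uniform-floor normal form of the matrix landed by the sibling disprover
  (`Summit.HubbardSuperconductivity.WcbcsSsbToTorusLRO.Negative.floor_of_hasDWavePairFieldLROAt`).
* `saturated_iff_energy_eq` — the ENERGY FORM: that saturation condition holds iff the fully polarised sector
  `(N_L, N_L/2)` (a free spinless band) attains the `(N_L, 0)` sector energy; by `SU(2)` descent/ascent
  (`saturated_descendant`, `saturated_ascent`: `(S⁻)ⁿ` is injective on the way down, `‖S⁺u‖² = (n(n+1) - j(j+1))‖u‖²`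
  on the way up, route NoGo's spin algebra) and the variational principle on both sectors.
* `ssbToEvenTorusLro_imp_noOrder_of_eventually_saturated` — reading for the crux: in a saturated-ferromagnetic
  corner the crux asserts the absence of density-matched Koma–Tasaki `d`-wave order.

Ferromagnetic input: OPEN at positive hole density for every finite `U` (Tasaki, Prog. Theor. Phys. 99 (1998) 489 =
arXiv:cond-mat/9712219, §4.4: "there are no rigorous results about the stability of Nagaoka's ferromagnetism");
EXCLUDED for `0 ≤ U < ε_{N_e} - ε₁` on every finite lattice (ibid. Thm 3.2), which covers the route's box `U ≤ 3`
(occupied spinless width `≥ 4.7` for `δ ≤ 7/20` on the square torus). Sources: H. Tasaki (1998) §3.2–3.3, §4.4;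
E. H. Lieb, PRL 62 (1989) 1201 (sectors, `S ≤ N/2`); H. Tasaki, *Physics and Mathematics of Quantum Many-Body
Systems* (2020) §2.4. All statements are elementary bookkeeping.
-/

noncomputable section

namespace Summit.HubbardSuperconductivity.HubbardSuperconductivity.Theorems.SsbToEvenTorusLro.Negative

open Literature.MathematicalPhysics.QuantumLattice Literature.Barriers.HubbardSuperconductivity
open Literature.Probability.LatticeModels
open Filter Set Matrix HubbardWave0
open scoped ComplexOrder
open _root_.Topology
open Summit.HubbardSuperconductivity.HubbardSuperconductivity.Theses.AposterioriCapRg (SsbToEvenTorusLro)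

/-! ### 4. Saturated ferromagnetism kills the summit matrix -/

/-- **Saturated ferromagnetism on all large tori kills the summit matrix** at `(U, δ)` (any `U`, `δ ≥ -1`): if from
some side on the sector `(N_L, S^z = 0)` of the pure Hubbard torus contains a ground state of maximal total spin
(`S²ψ = n(n+1)ψ`, `n = N_L/2`), then along the admissible sequence picking that member the `d`-wave pair correlations
vanish identically (route NoGo, crux 5: `Summit.HubbardSuperconductivity.NoGo.pairFieldCorr_succ_eq_zero_of_saturated`),
so `HasDWavePairFieldLROAt U δ` fails. The ferromagnetic input is open at positive hole density
(Tasaki, Prog. Theor. Phys. 99 (1998) 489, §4.4). [folklore] -/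
theorem not_hasDWavePairFieldLROAt_of_eventually_saturated {U δ : ℝ} (hδ : -1 ≤ δ)
    (hFM : ∀ᶠ L : ℕ in atTop, ∃ ψ : Fock (Orb (FermionTorus 2 L)),
      IsGroundStateInSector (hubbardTorus 2 L 1 U) (2 * ⌊(1 - δ) * (L : ℝ) ^ 2 / 2⌋₊) 0 ψ ∧
        spinSq *ᵥ ψ = (((⌊(1 - δ) * (L : ℝ) ^ 2 / 2⌋₊ : ℝ) * ((⌊(1 - δ) * (L : ℝ) ^ 2 / 2⌋₊ : ℝ) + 1) : ℝ) : ℂ) • ψ) :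
    ¬ HasDWavePairFieldLROAt U δ := by
  intro h
  obtain ⟨L₀, hL₀⟩ := eventually_atTop.1 hFM
  choose ψ hψ using fun L => Summit.HubbardSuperconductivity.NoGo.exists_unit_groundStateInSector_saturated L U
    (Summit.HubbardSuperconductivity.NoGo.floor_pairNumber_le δ hδ L) (L₀ ≤ L) (fun hL => hL₀ L hL)
  have hl := h (fun L => 2 * ⌊(1 - δ) * (L : ℝ) ^ 2 / 2⌋₊) ψ fun L _ => ⟨rfl, (hψ L).1, (hψ L).2.1⟩
  have hzero : ∀ L : ℕ, L₀ ≤ L → ∀ x y : TorusSite 2 L, pairFieldCorr dWaveFormFactor ψ L x y = 0 := by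
    intro L hL x y
    cases L with
    | zero => rfl
    | succ L =>
      have hS := (hψ (L + 1)).2.2 hL
      have hS' : spinSq *ᵥ ψ (L + 1) =
          (((((2 * ⌊(1 - δ) * ((L + 1 : ℕ) : ℝ) ^ 2 / 2⌋₊ : ℕ) : ℝ) / 2) *
            ((((2 * ⌊(1 - δ) * ((L + 1 : ℕ) : ℝ) ^ 2 / 2⌋₊ : ℕ) : ℝ) / 2) + 1) : ℝ) : ℂ) • ψ (L + 1) := by
        rw [hS]; congr 2; push_cast; ring
      exact Summit.HubbardSuperconductivity.NoGo.pairFieldCorr_succ_eq_zero_of_saturated dWaveFormFactor ψ L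
        ((mem_szSector_iff _ _ _).1 (hψ (L + 1)).2.1.1).1 hS' x y
  unfold HasLongRangeOrder at hl
  have hev : ∀ᶠ k : ℕ in atTop,
      (∑ x ∈ halfOpenBox 2 (2 * k), ∑ y ∈ halfOpenBox 2 (2 * k),
          torusPullback (pairFieldCorr dWaveFormFactor ψ) (2 * k) x y) /
        ((halfOpenBox 2 (2 * k)).card : ℝ) ^ 2 = (fun _ : ℕ => (0 : ℝ)) k := by
    refine eventually_atTop.2 ⟨L₀, fun k hk => ?_⟩
    simp only [torusPullback_apply, hzero (2 * k) (by omega), Finset.sum_const_zero, zero_div]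
  rw [liminf_congr hev, liminf_const] at hl
  exact lt_irrefl _ hl

/-- **Infinitely many even tori suffice** (`δ ≥ 0`), by the UNIFORM-FLOOR normal form of the summit matrix landed by
the sibling disprover (`Summit.HubbardSuperconductivity.WcbcsSsbToTorusLRO.Negative.floor_of_hasDWavePairFieldLROAt`):
a saturated member on infinitely many even sides contradicts the floor `a(2k+2)⁴ ≤ Re⟨ψ, P†Pψ⟩` (`Pψ = 0` there,
route NoGo's `pairField_mulVec_eq_zero_of_saturated`). [folklore] -/
theorem not_hasDWavePairFieldLROAt_of_frequently_saturated {U δ : ℝ} (hδ : 0 ≤ δ)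
    (hFM : ∃ᶠ k : ℕ in atTop, ∃ ψ : Fock (Orb (FermionTorus 2 (2 * k + 1 + 1))),
      IsGroundStateInSector (hubbardTorus 2 (2 * k + 1 + 1) 1 U)
          (2 * ⌊(1 - δ) * ((2 * k + 1 + 1 : ℕ) : ℝ) ^ 2 / 2⌋₊) 0 ψ ∧
        spinSq *ᵥ ψ = (((⌊(1 - δ) * ((2 * k + 1 + 1 : ℕ) : ℝ) ^ 2 / 2⌋₊ : ℝ) *
          ((⌊(1 - δ) * ((2 * k + 1 + 1 : ℕ) : ℝ) ^ 2 / 2⌋₊ : ℝ) + 1) : ℝ) : ℂ) • ψ) :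
    ¬ HasDWavePairFieldLROAt U δ := by
  intro h
  obtain ⟨a, ha, hev⟩ :=
    Summit.HubbardSuperconductivity.WcbcsSsbToTorusLRO.Negative.floor_of_hasDWavePairFieldLROAt hδ h
  obtain ⟨k, hk, ψ, hgs, hS⟩ := (hev.and_frequently hFM).exists
  obtain ⟨c, hc0, hc1⟩ := exists_smul_unit hgs.2.1
  have hle := hk (c • ψ) (isGroundStateInSector_smul hgs hc0) hc1
  have hN : IsNParticle (2 * ⌊(1 - δ) * ((2 * k + 1 + 1 : ℕ) : ℝ) ^ 2 / 2⌋₊) ψ :=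
    ((mem_szSector_iff _ _ _).1 hgs.1).1
  have hS' : spinSq *ᵥ ψ =
      (((((2 * ⌊(1 - δ) * ((2 * k + 1 + 1 : ℕ) : ℝ) ^ 2 / 2⌋₊ : ℕ) : ℝ) / 2) *
        ((((2 * ⌊(1 - δ) * ((2 * k + 1 + 1 : ℕ) : ℝ) ^ 2 / 2⌋₊ : ℕ) : ℝ) / 2) + 1) : ℝ) : ℂ) • ψ := by
    rw [hS]; congr 2; push_cast; ring
  have hP : pairField dWaveFormFactor (2 * k + 1 + 1) *ᵥ (c • ψ) = 0 := by
    rw [mulVec_smul, Summit.HubbardSuperconductivity.NoGo.pairField_mulVec_eq_zero_of_saturated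
      dWaveFormFactor (2 * k + 1 + 1) hN hS', smul_zero]
  rw [expect, ← mulVec_mulVec, hP, mulVec_zero, dotProduct_zero, Complex.zero_re] at hle
  have hpos : 0 < a * ((2 * k + 1 + 1 : ℕ) : ℝ) ^ 4 := by positivity
  linarith

/-- Reading for the crux `SsbToEvenTorusLro`: in a saturated-ferromagnetic corner it ASSERTS the absence of
density-matched Koma–Tasaki `d`-wave order at that coupling (a saturated ferromagnet has no singlet order, so the
body of the crux is vacuous there; the hazard is a first-order ferromagnet/`d`-wave boundary in `μ` at strong
coupling, outside the route's box by Tasaki 1998 Thm 3.2). [folklore] -/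
theorem ssbToEvenTorusLro_imp_noOrder_of_eventually_saturated (hc : SsbToEvenTorusLro) {U δ : ℝ} (hU : 0 < U)
    (hδ : δ ∈ Ioo (0:ℝ) 1)
    (hFM : ∀ᶠ L : ℕ in atTop, ∃ ψ : Fock (Orb (FermionTorus 2 L)),
      IsGroundStateInSector (hubbardTorus 2 L 1 U) (2 * ⌊(1 - δ) * (L : ℝ) ^ 2 / 2⌋₊) 0 ψ ∧
        spinSq *ᵥ ψ = (((⌊(1 - δ) * (L : ℝ) ^ 2 / 2⌋₊ : ℝ) * ((⌊(1 - δ) * (L : ℝ) ^ 2 / 2⌋₊ : ℝ) + 1) : ℝ) : ℂ) • ψ)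
    (μ : ℝ)
    (hd : Tendsto (fun L : ℕ => ((hubbardTorusWith 2 (L + 1) 1 U μ).groundStateFunctional totalNumber).re /
      ((L + 1 : ℕ) : ℝ) ^ 2) atTop (𝓝 (1 - δ))) : ¬ HasDWaveOrder U μ :=
  fun ho => not_hasDWavePairFieldLROAt_of_eventually_saturated (by linarith [hδ.1]) hFM (hc U δ μ hU hδ hd ho)

/-! ### 5. The energy form of saturation: `SU(2)` descent and ascent -/

section Descent

variable {Λ : Type*} [LinearOrder Λ] [Fintype Λ]

/-- `(S⁻)ʲ` maps a nonzero vector of the fully polarised sector `(2n, 0)` to a NONZERO vector of the sector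
`(2n - j, j)`, `j ≤ n` (`S⁻` is injective while `N↓ < N↑`). Lieb, PRL 62 (1989) 1201, proof of Theorem 1. [folklore] -/
theorem isInSector_spinMinus_pow_mulVec {n : ℕ} {φ : Fock (Orb Λ)} (hφ : IsInSector (2 * n) 0 φ) (hφ0 : φ ≠ 0) :
    ∀ j : ℕ, j ≤ n →
      IsInSector (2 * n - j) j (Literature.MathematicalPhysics.QuantumLattice.spinMinus ^ j *ᵥ φ) ∧
        Literature.MathematicalPhysics.QuantumLattice.spinMinus ^ j *ᵥ φ ≠ 0 := by
  intro j
  induction j with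
  | zero =>
    intro _
    simpa using And.intro hφ hφ0
  | succ j ih =>
    intro hj
    obtain ⟨hs, hne⟩ := ih (by omega)
    have e : 2 * n - j = (2 * n - (j + 1)) + 1 := by omega
    rw [e] at hs
    refine ⟨?_, ?_⟩
    · rw [pow_succ', ← mulVec_mulVec]
      exact LiebThm1.lowersSpin_spinMinus.isInSector_mulVec hs
    · rw [pow_succ', ← mulVec_mulVec]
      exact fun h0 => hne (LiebThm1.eq_zero_of_spinMinus_mulVec_eq_zero (by omega) hs h0)

/-- A vector of the fully polarised sector `(2n, 0)` has maximal total spin, `S²φ = n(n+1)φ` (`S⁺φ = 0`, `S^zφ = nφ`,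
`S⁻S⁺ = S² - (S^z)² - S^z`). Tasaki (2020) §2.4. [folklore] -/
theorem spinSq_mulVec_of_isInSector_top {n : ℕ} {φ : Fock (Orb Λ)} (hφ : IsInSector (2 * n) 0 φ) :
    spinSq *ᵥ φ = (((n : ℝ) * ((n : ℝ) + 1) : ℝ) : ℂ) • φ := by
  have hP : spinPlus *ᵥ φ = 0 := LiebThm1.raisesSpin_spinPlus.mulVec_eq_zero hφ
  have hZ := LiebThm1.spinZ_mulVec_of_isInSector hφ
  have h : (Literature.MathematicalPhysics.QuantumLattice.spinMinus * spinPlus : Matrix (Finset (Orb Λ)) _ ℂ) *ᵥ φ =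
      (spinSq - HubbardWave0.spinZ * HubbardWave0.spinZ - HubbardWave0.spinZ) *ᵥ φ := by
    rw [Summit.HubbardSuperconductivity.NoGo.spinMinus_mul_spinPlus_eq]
  rw [← mulVec_mulVec, hP, mulVec_zero, sub_mulVec, sub_mulVec, ← mulVec_mulVec, hZ, mulVec_smul, hZ,
    smul_smul, sub_sub, eq_comm, sub_eq_zero, ← add_smul] at h
  rw [h]
  congr 1
  push_cast
  ring

/-- **`SU(2)` descent, packaged**: from a nonzero `H`-eigenvector of the fully polarised sector `(2n, 0)` to a nonzero
`H`-eigenvector of the `S^z = 0` sector `(n, n)` with the same eigenvalue and maximal total spin `S² = n(n+1)`, for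
any `H` commuting with `S⁻`. Lieb, PRL 62 (1989) 1201, proof of Theorem 1. [folklore] -/
theorem saturated_descendant (H : Matrix (Finset (Orb Λ)) (Finset (Orb Λ)) ℂ)
    (hH : Commute H Literature.MathematicalPhysics.QuantumLattice.spinMinus) {n : ℕ} {φ : Fock (Orb Λ)}
    (hφ : IsInSector (2 * n) 0 φ) (hφ0 : φ ≠ 0) {E : ℂ} (hE : H *ᵥ φ = E • φ) :
    ∃ w : Fock (Orb Λ), IsInSector n n w ∧ w ≠ 0 ∧ H *ᵥ w = E • w ∧
      spinSq *ᵥ w = (((n : ℝ) * ((n : ℝ) + 1) : ℝ) : ℂ) • w := by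
  obtain ⟨hw, hw0⟩ := isInSector_spinMinus_pow_mulVec hφ hφ0 n le_rfl
  have hnn : 2 * n - n = n := by omega
  rw [hnn] at hw
  refine ⟨_, hw, hw0, ?_, ?_⟩
  · rw [mulVec_mulVec, (hH.pow_right n).eq, ← mulVec_mulVec, hE, mulVec_smul]
  · have hSS : (spinSq : Matrix (Finset (Orb Λ)) _ ℂ) * Literature.MathematicalPhysics.QuantumLattice.spinMinus ^ n =
        Literature.MathematicalPhysics.QuantumLattice.spinMinus ^ n * spinSq := by
      rw [← LiebTwo.su2Casimir_spin_eq_spinSq]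
      exact LiebTwo.isSu2Triple_spin.su2Casimir_mul_M_pow n
    rw [mulVec_mulVec, hSS, ← mulVec_mulVec, spinSq_mulVec_of_isInSector_top hφ, mulVec_smul]

/-- **`SU(2)` ascent, packaged**: from a nonzero `H`-eigenvector of the `S^z = 0` sector `(n, n)` with MAXIMAL total
spin `S² = n(n+1)` to a nonzero `H`-eigenvector of the fully polarised sector `(2n, 0)` with the same eigenvalue, for
any `H` commuting with `S⁺` (`‖S⁺u‖² = (n(n+1) - j(j+1))‖u‖²` on the sector `(n+j, n-j)`). Tasaki (2020) §2.4;
Lieb, PRL 62 (1989) 1201. [folklore] -/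
theorem saturated_ascent (H : Matrix (Finset (Orb Λ)) (Finset (Orb Λ)) ℂ) (hH : Commute H spinPlus) {n : ℕ}
    {ψ : Fock (Orb Λ)} (hψ : IsInSector n n ψ) (hψ0 : ψ ≠ 0) {E : ℂ} (hE : H *ᵥ ψ = E • ψ)
    (hS : spinSq *ᵥ ψ = (((n : ℝ) * ((n : ℝ) + 1) : ℝ) : ℂ) • ψ) :
    ∃ u : Fock (Orb Λ), IsInSector (2 * n) 0 u ∧ u ≠ 0 ∧ H *ᵥ u = E • u := by
  have key : ∀ j : ℕ, j ≤ n → IsInSector (n + j) (n - j) (spinPlus ^ j *ᵥ ψ) ∧ spinPlus ^ j *ᵥ ψ ≠ 0 ∧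
      spinSq *ᵥ (spinPlus ^ j *ᵥ ψ) = (((n : ℝ) * ((n : ℝ) + 1) : ℝ) : ℂ) • (spinPlus ^ j *ᵥ ψ) := by
    intro j
    induction j with
    | zero =>
      intro _
      simpa using And.intro hψ (And.intro hψ0 hS)
    | succ j ih =>
      intro hj
      obtain ⟨hs, hne, hSj⟩ := ih (by omega)
      have hSsucc : spinSq *ᵥ (spinPlus ^ (j + 1) *ᵥ ψ) =
          (((n : ℝ) * ((n : ℝ) + 1) : ℝ) : ℂ) • (spinPlus ^ (j + 1) *ᵥ ψ) := by
        have hc : (spinSq * spinPlus : Matrix (Finset (Orb Λ)) _ ℂ) = spinPlus * spinSq := by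
          rw [← LiebTwo.su2Casimir_spin_eq_spinSq]; exact LiebTwo.isSu2Triple_spin.su2Casimir_mul_P
        rw [pow_succ', ← mulVec_mulVec, mulVec_mulVec, hc, ← mulVec_mulVec, hSj, mulVec_smul]
      have hne' : spinPlus ^ (j + 1) *ᵥ ψ ≠ 0 := by
        rw [pow_succ', ← mulVec_mulVec]
        intro h0
        have hnorm : star (spinPlus *ᵥ (spinPlus ^ j *ᵥ ψ)) ⬝ᵥ (spinPlus *ᵥ (spinPlus ^ j *ᵥ ψ)) =
            ((((n : ℝ) * ((n : ℝ) + 1) - (j : ℝ) * j - j : ℝ)) : ℂ) *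
              (star (spinPlus ^ j *ᵥ ψ) ⬝ᵥ (spinPlus ^ j *ᵥ ψ)) := by
          rw [Summit.HubbardSuperconductivity.NoGo.star_spinPlus_mulVec_dotProduct hs hSj]
          congr 1
          rw [Nat.cast_sub (show j ≤ n by omega)]
          push_cast
          ring
        rw [h0, dotProduct_zero] at hnorm
        have hpos : (0 : ℝ) < (n : ℝ) * ((n : ℝ) + 1) - (j : ℝ) * j - j := by
          have hj' : (j : ℝ) + 1 ≤ n := by exact_mod_cast hj
          have hj0 : (0 : ℝ) ≤ j := Nat.cast_nonneg j
          nlinarith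
        have h0' : star (spinPlus ^ j *ᵥ ψ) ⬝ᵥ (spinPlus ^ j *ᵥ ψ) = 0 :=
          (mul_eq_zero.1 hnorm.symm).resolve_left (by exact_mod_cast hpos.ne')
        exact hne (dotProduct_star_self_eq_zero.1 h0')
      have e : n - j = (n - (j + 1)) + 1 := by omega
      rw [e] at hs
      refine ⟨?_, hne', hSsucc⟩
      rw [show n + (j + 1) = (n + j) + 1 by ring, pow_succ', ← mulVec_mulVec]
      exact LiebThm1.raisesSpin_spinPlus.isInSector_mulVec hs
  obtain ⟨hs, hne, -⟩ := key n le_rfl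
  rw [show n + n = 2 * n by ring, Nat.sub_self] at hs
  refine ⟨_, hs, hne, ?_⟩
  rw [mulVec_mulVec, (hH.pow_right n).eq, ← mulVec_mulVec, hE, mulVec_smul]

end Descent

/-- **Energy form ⇒ saturation.** If the fully polarised sector `(2n, S^z = n)` of the pure Hubbard torus attains the
`(2n, S^z = 0)` sector energy, the `S^z = 0` sector contains a saturated ground state (the `(S⁻)ⁿ`-descendant of a
top-sector ground state). Tasaki, Prog. Theor. Phys. 99 (1998) 489, §3.2. [folklore] -/
theorem saturatedGS_of_energy_eq (U : ℝ) (L n : ℕ) (hn : 2 * n ≤ L ^ 2)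
    (hE : (hubbardTorus 2 L 1 U).minEnergyOn (szSector (2 * n) (((2 * n : ℕ) : ℝ) / 2)) =
      (hubbardTorus 2 L 1 U).minEnergyOn (szSector (2 * n) 0)) :
    ∃ ψ : Fock (Orb (FermionTorus 2 L)), IsGroundStateInSector (hubbardTorus 2 L 1 U) (2 * n) 0 ψ ∧
      spinSq *ᵥ ψ = (((n : ℝ) * ((n : ℝ) + 1) : ℝ) : ℂ) • ψ := by
  obtain ⟨φ, -, hφ⟩ := exists_unit_isGroundStateInSector_top U L (2 * n) hn
  have hsec : IsInSector (2 * n) 0 φ := (mem_szSector_top_iff _ _).1 hφ.1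
  have hc : Commute (hubbardTorus 2 L 1 U) Literature.MathematicalPhysics.QuantumLattice.spinMinus :=
    LiebThm1.hamiltonian_commute_spinMinus (fermionTorusGraph 2 L) 1 U
  obtain ⟨w, hw, hw0, hHw, hSw⟩ := saturated_descendant (hubbardTorus 2 L 1 U) hc hsec hφ.2.1 hφ.2.2
  refine ⟨w, ⟨(mem_szSector_two_mul_zero_iff n w).2 hw, hw0, ?_⟩, hSw⟩
  rw [← hE]
  exact hHw

/-- `E_min(2n, S^z = 0) ≤ E_min(2n, S^z = n)` always: every top-sector energy occurs in the `S^z = 0` sector (descent +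
the variational principle on the `(n, n)` sector). Lieb, PRL 62 (1989) 1201, proof of Theorem 1. [folklore] -/
theorem minEnergyOn_zero_le_top (U : ℝ) (L n : ℕ) (hn : 2 * n ≤ L ^ 2) :
    (hubbardTorus 2 L 1 U).minEnergyOn (szSector (2 * n) 0) ≤
      (hubbardTorus 2 L 1 U).minEnergyOn (szSector (2 * n) (((2 * n : ℕ) : ℝ) / 2)) := by
  obtain ⟨φ, -, hφ⟩ := exists_unit_isGroundStateInSector_top U L (2 * n) hn
  have hsec : IsInSector (2 * n) 0 φ := (mem_szSector_top_iff _ _).1 hφ.1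
  have hc : Commute (hubbardTorus 2 L 1 U) Literature.MathematicalPhysics.QuantumLattice.spinMinus :=
    LiebThm1.hamiltonian_commute_spinMinus (fermionTorusGraph 2 L) 1 U
  obtain ⟨w, hw, hw0, hHw, -⟩ := saturated_descendant (hubbardTorus 2 L 1 U) hc hsec hφ.2.1 hφ.2.2
  have hcard : n ≤ Fintype.card (FermionTorus 2 L) := by
    have : n ≤ L ^ 2 := by omega
    simpa [FermionTorus, Fintype.card_fin] using this
  have hb : (hubbardTorus 2 L 1 U).minEnergyOn (szSector (2 * n) 0) * (star w ⬝ᵥ w).re ≤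
      (expect (hubbardTorus 2 L 1 U) w).re :=
    (szSector_groundState (fermionTorusGraph 2 L) 1 U hcard).2 w hw
  rw [expect, hHw, dotProduct_smul, smul_eq_mul, Complex.re_ofReal_mul] at hb
  have hpos : 0 < (star w ⬝ᵥ w).re := (Complex.pos_iff.1 (dotProduct_star_self_pos_iff.2 hw0)).1
  exact le_of_mul_le_mul_right hb hpos

/-- **Saturation ⇒ energy form**: a saturated ground state in the `S^z = 0` sector raises, by `(S⁺)ⁿ`, to a top-sector
eigenvector with the `(2n, 0)` energy, so `E_min(2n, n) ≤ E_min(2n, 0)`. Tasaki (2020) §2.4. [folklore] -/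
theorem minEnergyOn_top_le_zero_of_saturated (U : ℝ) (L n : ℕ) (hn : 2 * n ≤ L ^ 2)
    (h : ∃ ψ : Fock (Orb (FermionTorus 2 L)), IsGroundStateInSector (hubbardTorus 2 L 1 U) (2 * n) 0 ψ ∧
      spinSq *ᵥ ψ = (((n : ℝ) * ((n : ℝ) + 1) : ℝ) : ℂ) • ψ) :
    (hubbardTorus 2 L 1 U).minEnergyOn (szSector (2 * n) (((2 * n : ℕ) : ℝ) / 2)) ≤
      (hubbardTorus 2 L 1 U).minEnergyOn (szSector (2 * n) 0) := by
  obtain ⟨ψ, hgs, hS⟩ := h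
  have hsec : IsInSector n n ψ := (mem_szSector_two_mul_zero_iff n ψ).1 hgs.1
  have hc : Commute (hubbardTorus 2 L 1 U) spinPlus := LiebThm1.hamiltonian_commute_spinPlus (fermionTorusGraph 2 L) 1 U
  obtain ⟨u, hu, hu0, hHu⟩ := saturated_ascent (hubbardTorus 2 L 1 U) hc hsec hgs.2.1 hgs.2.2 hS
  obtain ⟨c, hc0, hc1⟩ := exists_smul_unit hu0
  have hmem : c • u ∈ szSector (2 * n) (((2 * n : ℕ) : ℝ) / 2) :=
    Submodule.smul_mem _ c ((mem_szSector_top_iff _ _).2 hu)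
  have hb := (top_sector_groundState U L (2 * n) hn).2 (c • u) hmem hc1
  have hHcu : hubbardTorus 2 L 1 U *ᵥ (c • u) =
      (((hubbardTorus 2 L 1 U).minEnergyOn (szSector (2 * n) 0) : ℝ) : ℂ) • (c • u) := by
    rw [mulVec_smul, hHu, smul_comm]
  rw [hHcu, dotProduct_smul, hc1, smul_eq_mul, mul_one, Complex.ofReal_re] at hb
  exact hb

/-- **Saturated ferromagnetism of the summit's sector ⟺ the fully polarised sector attains the sector energy**
(`δ ≥ 0`; the fully polarised sector `(N_L, N_L/2)` is a free spinless band, energy `= Σ` of the `N_L` lowest `ε(k)`):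
the hypothesis of `not_hasDWavePairFieldLROAt_of_eventually_saturated` in the form in which (in)stability of Nagaoka
ferromagnetism is stated in print. Tasaki, Prog. Theor. Phys. 99 (1998) 489, §3.2–3.3 and §4.4. [folklore] -/
theorem saturated_iff_energy_eq {U δ : ℝ} (hδ : 0 ≤ δ) (L : ℕ) :
    (∃ ψ : Fock (Orb (FermionTorus 2 L)),
      IsGroundStateInSector (hubbardTorus 2 L 1 U) (2 * ⌊(1 - δ) * (L : ℝ) ^ 2 / 2⌋₊) 0 ψ ∧
        spinSq *ᵥ ψ = (((⌊(1 - δ) * (L : ℝ) ^ 2 / 2⌋₊ : ℝ) * ((⌊(1 - δ) * (L : ℝ) ^ 2 / 2⌋₊ : ℝ) + 1) : ℝ) : ℂ) • ψ) ↔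
      (hubbardTorus 2 L 1 U).minEnergyOn
          (szSector (2 * ⌊(1 - δ) * (L : ℝ) ^ 2 / 2⌋₊) (((2 * ⌊(1 - δ) * (L : ℝ) ^ 2 / 2⌋₊ : ℕ) : ℝ) / 2)) =
        (hubbardTorus 2 L 1 U).minEnergyOn (szSector (2 * ⌊(1 - δ) * (L : ℝ) ^ 2 / 2⌋₊) 0) :=
  ⟨fun h => le_antisymm (minEnergyOn_top_le_zero_of_saturated U L _ (two_mul_natFloor_le_sq hδ L) h)
      (minEnergyOn_zero_le_top U L _ (two_mul_natFloor_le_sq hδ L)),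
    saturatedGS_of_energy_eq U L _ (two_mul_natFloor_le_sq hδ L)⟩

end Summit.HubbardSuperconductivity.HubbardSuperconductivity.Theorems.SsbToEvenTorusLro.Negative
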